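import Mathlib.Data.List.Infix
import Mathlib.Data.List.Sublists
import Mathlib.Data.Nat.Find
import Mathlib.Data.ENat.Basic
import Mathlib.Data.Set.Finite.List
import Mathlib.Data.Set.Finite.Powerset
import Mathlib.Order.MinMax
import Mathlib.Logic.Relation
import Literature.Combinatorics.Words.SubwordReconstruction
import HarnessLib

/-!
# The subword distance and Simon's congruences `J_m` (Lothaire, *Combinatorics on Words*, §6.2)

Topic `Literature/Combinatorics/Words`; continues
`Literature/Combinatorics/Words/SubwordReconstruction.lean`, which introduced the relation
`SubwordEquiv m f g` ("`f ≡ g [J_m]`": `f` and `g` have the same subwords — scattered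
subsequences, `List.Sublist` — of length `≤ m`, Lothaire (6.2.4) / Example 6.2.1) and proved
6.2.1–6.2.3 and 6.2.16–6.2.20. This file transcribes the part of §6.2 due to Simon (1975)
on the structure of the congruence classes of `J_m`:

* `subwordSet m f` — the set `S(m, f)` of subwords of `f` of length `≤ m`;
  `subwordEquiv_iff_subwordSet_eq`; `subwordEquiv_one_iff` (Example 6.2.1: `J_1` is
  equality of alphabets).
* **Proposition 6.2.4** — `SubwordEquiv.append` (`J_m` is a congruence) and
  `finite_range_subwordSet` (it has finite index over a finite alphabet: there are finitely
  many sets `S(m, f)`).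
* `subwordDist f g : ℕ∞` — the subword distance `δ(f, g) = max {m | f ≡ g [J_m]}`
  (`= ⊤` iff `f = g`), with the defining property `natCast_le_subwordDist_iff :
  ↑m ≤ δ(f, g) ↔ f ≡ g [J_m]`, symmetry, (6.2.5) `min_subwordDist_le`
  (`δ(f, g) ≥ min {δ(f, h), δ(g, h)}`) and **Proposition 6.2.10** `subwordDist_eq_min`
  (if `δ(f, g) ≤ δ(f, h)` then `δ(f, g) = min {δ(f, h), δ(g, h)}`: an ultrametric space).
* `Distinguishes z f g` — `z` is a subword of exactly one of `f`, `g`;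
  `subwordDist_lt_length` / `exists_distinguishes_length` (the shortest distinguishing words
  have length `δ(f, g) + 1`).
* **Lemma 6.2.12** `distinguishes_append_singleton_iff`, `exists_shortest_append_singleton`
  (the shortest words distinguishing `ua` and `u` are the `sa` with `|s| = δ(ua, u)`) and the
  dual statements for `av`, `v`.
* **Lemma 6.2.13** `subwordDist_insert_eq_add`: `δ(uav, uv) = δ(ua, u) + δ(av, v)`.
* **Lemma 6.2.14** `subwordDist_le_max`: for letters `a ≠ b`,
  `δ(uav, ubw) ≤ max {δ(ubav, uav), δ(uabw, ubw)}`.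
* **Theorem 6.2.11** `exists_superword_subwordDist_eq_min`: for all `f`, `g` there is a common
  superword `h` (`f ∣ h`, `g ∣ h`) with `δ(f, g) = min {δ(f, h), δ(g, h)}`; whence
  **Theorem 6.2.6** `SubwordEquiv.exists_common_superword`: if `f ≡ g [J_m]` there is `h ≡ f`
  with `f ∣ h` and `g ∣ h`.
* **Corollary 6.2.8** `SubwordEquiv.insert_letter_pump` (if `uv ≡ uav` then `uv ≡ uaⁿv` for
  all `n`, via the text's step `uav ≡ ua²v`) and `subwordEquiv_class_singleton_or_infinite`
  (every `J_m`-class is a singleton or infinite).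
* **(6.2.19)** `subwordEquiv_append_flatten` (if `v = v₁ ⋯ v_m` with
  `alph(t) ⊆ alph(v₁) ⊆ ⋯ ⊆ alph(v_m)` then `tv ≡ v [J_m]`), with its two embedding lemmas
  `sublist_flatten_of_forall_mem`, `sublist_flatten_drop_of_pairwise_subset`;
  **Corollary 6.2.16** `subwordEquiv_pow_cons_pow`: `(fg)^m ≡ g(fg)^m [J_m]`;
  **Example 6.2.7** (kernel-checked).
* **Problems** 6.2.2 `subwordEquiv_cons_iff_of_two_letters` (`af ≡ bg [J_m]` over `{a, b}`
  iff `S(m, af) = S(m, bg) = A^{≤ m}`), 6.2.3 `subwordEquiv_cons_cons_iff_of_two_letters`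
  (`abf ≡ abg [J_{m+1}]` iff `f ≡ g [J_m]`), 6.2.5 `reflTransGen_insertStep_iff`,
  `subwordEquiv_iff_join_insertStep`, `subwordEquiv_iff_eqvGen_insertStep` (the one-letter
  insertion relation `R_m`: `R_m^* = (∣) ∩ J_m`, `J_m = R_m^{-1*} ∘ R_m^* = (R_m ∪ R_m^{-1})^*`),
  6.2.6 `subwordEquiv_class_eq_singleton_iff`, 6.2.7 `minimal_in_subwordEquiv_class_iff`
  (singleton classes / minimal elements via `δ(gah, gh) < m`).

Deviations. (i) Theorem 6.2.11 is proved, as in the text, by induction on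
`d(f, g) = |f| + |g| − 2|f ∧ g|`; we phrase the induction as "on `|f'| + |g'|` over all
factorizations `f = u f'`, `g = u g'`", which avoids introducing the longest common prefix.
(ii) `δ` is `ℕ∞`-valued (`⊤` for `∞`); the text's conventions `δ(f, f) = ∞` and
"`δ(f, g) + 1` is the length of a shortest distinguishing word" are theorems here.
NOT transcribed: Theorem 6.2.5 (boolean combinations of shuffle ideals), Theorem 6.2.9
(Simon 1972, stated without proof in the text), the second half of Proposition 6.2.15 (the
computation of `δ(tv, v)` by the numbers `k(t, v)`, `h(t, v)`; only its criterion (6.2.19) is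
here), and Problems 6.2.1, 6.2.4 (algorithms) and 6.2.8–6.2.13.
Everything below is proved; no `sorry`. [cite: Lothaire1997, §6.2]
-/

namespace Literature.Combinatorics.Words

open List

variable {α : Type*}

/-! ### The sets `S(m, f)`; `J_m` is a congruence of finite index (Proposition 6.2.4) -/

section Congruence

/-- `S(m, f)`: the set of subwords of `f` of length at most `m` (text before (6.2.4)).
[cite: Lothaire1997, §6.2 (6.2.4)] -/
def subwordSet (m : ℕ) (f : List α) : Set (List α) := {s | s.length ≤ m ∧ s <+ f}

/-- Membership in `S(m, f)`. [cite: Lothaire1997, §6.2 (6.2.4)] -/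
theorem mem_subwordSet_iff {m : ℕ} {f s : List α} :
    s ∈ subwordSet m f ↔ s.length ≤ m ∧ s <+ f := Iff.rfl

/-- (6.2.4): `f ≡ g [J_m]` iff `S(m, f) = S(m, g)`. [cite: Lothaire1997, §6.2 (6.2.4)] -/
theorem subwordEquiv_iff_subwordSet_eq {m : ℕ} {f g : List α} :
    SubwordEquiv m f g ↔ subwordSet m f = subwordSet m g := by
  constructor
  · intro h
    ext s
    simp only [mem_subwordSet_iff]
    exact ⟨fun hs => ⟨hs.1, (h s hs.1).1 hs.2⟩, fun hs => ⟨hs.1, (h s hs.1).2 hs.2⟩⟩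
  · intro h s hs
    have h1 := Set.ext_iff.1 h s
    simp only [mem_subwordSet_iff] at h1
    exact ⟨fun h' => (h1.1 ⟨hs, h'⟩).2, fun h' => (h1.2 ⟨hs, h'⟩).2⟩

/-- `S(m, f)` consists of words of length `≤ m`. [cite: Lothaire1997, §6.2 (6.2.4)] -/
theorem subwordSet_subset (m : ℕ) (f : List α) : subwordSet m f ⊆ {s | s.length ≤ m} :=
  fun _ hs => hs.1

/-- Example 6.2.1 (second half): `J_1` is the equivalence "same alphabet".
[cite: Lothaire1997, Example 6.2.1] -/
theorem subwordEquiv_one_iff {f g : List α} : SubwordEquiv 1 f g ↔ ∀ a, a ∈ f ↔ a ∈ g := by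
  constructor
  · intro h a
    simpa [singleton_sublist] using h [a] (by simp)
  · intro h s hs
    match s, hs with
    | [], _ => simp
    | [a], _ => simpa [singleton_sublist] using h a
    | _ :: _ :: _, hs => simp at hs

/-- **Proposition 6.2.4** (first half): `J_m` is a congruence — if `f ≡ g` and `f' ≡ g'` then
`ff' ≡ gg' [J_m]` (a subword of `ff'` of length `≤ m` splits into a subword of `f` and one of
`f'`, both of length `≤ m`). [cite: Lothaire1997, Proposition 6.2.4] -/
theorem SubwordEquiv.append {m : ℕ} {f g f' g' : List α} (h : SubwordEquiv m f g)
    (h' : SubwordEquiv m f' g') : SubwordEquiv m (f ++ f') (g ++ g') := by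
  suffices key : ∀ {f g f' g' : List α}, SubwordEquiv m f g → SubwordEquiv m f' g' →
      ∀ s : List α, s.length ≤ m → s <+ f ++ f' → s <+ g ++ g' from
    fun s hs => ⟨key h h' s hs, key h.symm h'.symm s hs⟩
  intro f g f' g' h h' s hs hsub
  obtain ⟨s₁, s₂, rfl, h₁, h₂⟩ := sublist_append_iff.1 hsub
  simp only [length_append] at hs
  exact ((h s₁ (by omega)).1 h₁).append ((h' s₂ (by omega)).1 h₂)

/-- `J_m` is a left congruence. [cite: Lothaire1997, Proposition 6.2.4] -/
theorem SubwordEquiv.append_left {m : ℕ} {f g : List α} (u : List α)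
    (h : SubwordEquiv m f g) : SubwordEquiv m (u ++ f) (u ++ g) :=
  (SubwordEquiv.refl m u).append h

/-- `J_m` is a right congruence. [cite: Lothaire1997, Proposition 6.2.4] -/
theorem SubwordEquiv.append_right {m : ℕ} {f g : List α} (v : List α)
    (h : SubwordEquiv m f g) : SubwordEquiv m (f ++ v) (g ++ v) :=
  h.append (SubwordEquiv.refl m v)

/-- **Proposition 6.2.4** (second half): over a finite alphabet `J_m` has finite index — the
classes are indexed by the sets `S(m, f)`, all contained in the finite set of words of length
`≤ m`, so there are finitely many of them. [cite: Lothaire1997, Proposition 6.2.4] -/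
theorem finite_range_subwordSet [Finite α] (m : ℕ) :
    (Set.range (subwordSet (α := α) m)).Finite :=
  (Set.Finite.finite_subsets (List.finite_length_le α m)).subset
    (by
      rintro _ ⟨f, rfl⟩
      exact subwordSet_subset m f)

/-- Sandwich: if `x ≡ y [J_m]` and `x ∣ z ∣ y` then `z ≡ y [J_m]` (used in the proof of
Corollary 6.2.8). [cite: Lothaire1997, Corollary 6.2.8] -/
theorem SubwordEquiv.of_sublist_of_sublist {m : ℕ} {x y z : List α} (h : SubwordEquiv m x y)
    (hxz : x <+ z) (hzy : z <+ y) : SubwordEquiv m z y :=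
  fun s hs => ⟨fun h' => h'.trans hzy, fun h' => ((h s hs).2 h').trans hxz⟩

/-- The splitting used throughout §6.2 ("`sat ∣ uv` implies `sa ∣ u` or `at ∣ v`"): if
`p c q` is a subword of `xy` then `p c` is a subword of `x` or `c q` is a subword of `y`.
[cite: Lothaire1997, Corollary 6.2.8 (proof)] -/
theorem sublist_append_split {p q x y : List α} {c : α} (h : p ++ c :: q <+ x ++ y) :
    p ++ [c] <+ x ∨ c :: q <+ y := by
  obtain ⟨l₁, l₂, he, h₁, h₂⟩ := sublist_append_iff.1 h
  rcases append_eq_append_iff.1 he with ⟨a', rfl, hq⟩ | ⟨c', rfl, rfl⟩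
  · -- `l₁ = p ++ a'`, `c :: q = a' ++ l₂`
    rcases a' with _ | ⟨d, a''⟩
    · right
      simp only [nil_append] at hq
      exact hq ▸ h₂
    · left
      simp only [cons_append, cons.injEq] at hq
      obtain ⟨rfl, -⟩ := hq
      exact (((nil_sublist a'').cons_cons _).append_left p).trans h₁
  · -- `p = l₁ ++ c'`, `l₂ = c' ++ c :: q`
    right
    exact ((sublist_append_right c' (c :: q)).trans h₂)

/-- A word `b t` with `b ≠ a` is a subword of `a v` only if it is a subword of `v`.
[cite: Lothaire1997, Lemma 6.2.14 (proof)] -/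
theorem cons_sublist_cons_of_ne {a b : α} {t v : List α} (hab : b ≠ a)
    (h : b :: t <+ a :: v) : b :: t <+ v := by
  rcases sublist_cons_iff.1 h with h | ⟨r, hr, _⟩
  · exact h
  · exact absurd (List.cons.inj hr).1 hab

end Congruence

/-! ### The subword distance `δ` -/

section Distance

/-- Distinct words are separated by some `J_m` (e.g. `m = |f| + 1`, Lemma 6.2.3 /
`SubwordEquiv.eq_of_length_lt`). [cite: Lothaire1997, §6.2 (before 6.2.5)] -/
theorem exists_not_subwordEquiv {f g : List α} (h : f ≠ g) : ∃ m, ¬ SubwordEquiv m f g :=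
  ⟨f.length + 1, fun H => h (H.eq_of_length_lt (Nat.lt_succ_self _))⟩

open Classical in
/-- The subword distance `δ(f, g) = max {m | f ≡ g [J_m]} ∈ ℕ ∪ {∞}` (`∞ = ⊤`, attained iff
`f = g`); for `f ≠ g` it is one less than the least `m` separating `f` and `g`.
[cite: Lothaire1997, §6.2 (before 6.2.5)] -/
noncomputable def subwordDist (f g : List α) : ℕ∞ :=
  if h : f = g then ⊤ else ((Nat.find (exists_not_subwordEquiv h) - 1 : ℕ) : ℕ∞)

/-- `δ(f, f) = ∞`. [cite: Lothaire1997, §6.2 (before 6.2.5)] -/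
@[simp] theorem subwordDist_self (f : List α) : subwordDist f f = ⊤ := by
  simp [subwordDist]

/-- The defining property of `δ`: `m ≤ δ(f, g)` iff `f ≡ g [J_m]`.
[cite: Lothaire1997, §6.2 (before 6.2.5)] -/
theorem natCast_le_subwordDist_iff {f g : List α} {m : ℕ} :
    (m : ℕ∞) ≤ subwordDist f g ↔ SubwordEquiv m f g := by
  classical
  unfold subwordDist
  split_ifs with h
  · subst h
    simp only [le_top, true_iff]
    exact SubwordEquiv.refl m f
  · have hspec := Nat.find_spec (exists_not_subwordEquiv h)
    have hpos : Nat.find (exists_not_subwordEquiv h) ≠ 0 := fun h0 =>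
      (Nat.find_eq_zero (exists_not_subwordEquiv h)).1 h0 (subwordEquiv_zero f g)
    rw [Nat.cast_le]
    constructor
    · intro hm
      by_contra hne
      have := Nat.find_min' (exists_not_subwordEquiv h) hne
      omega
    · intro hm
      by_contra hlt
      rw [not_le] at hlt
      exact hspec (hm.mono (by omega))

/-- Extensionality in `ℕ∞` through natural-number lower bounds (private helper).
[cite: Lothaire1997, §6.2 (before 6.2.5)] -/
private theorem enat_le_of_forall_natCast_le {a b : ℕ∞}
    (h : ∀ m : ℕ, (m : ℕ∞) ≤ a → (m : ℕ∞) ≤ b) : a ≤ b := by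
  induction b using ENat.recTopCoe with
  | top => exact le_top
  | coe n =>
    induction a using ENat.recTopCoe with
    | top => exact absurd (Nat.cast_le.1 (h (n + 1) le_top)) (by omega)
    | coe k => exact h k le_rfl

/-- `δ` is symmetric. [cite: Lothaire1997, §6.2 (before 6.2.5)] -/
theorem subwordDist_comm (f g : List α) : subwordDist f g = subwordDist g f :=
  le_antisymm
    (enat_le_of_forall_natCast_le fun _ hm =>
      natCast_le_subwordDist_iff.2 (natCast_le_subwordDist_iff.1 hm).symm)
    (enat_le_of_forall_natCast_le fun _ hm =>
      natCast_le_subwordDist_iff.2 (natCast_le_subwordDist_iff.1 hm).symm)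

/-- `δ(f, g) = ∞` iff `f = g`. [cite: Lothaire1997, §6.2 (before 6.2.5)] -/
theorem subwordDist_eq_top_iff {f g : List α} : subwordDist f g = ⊤ ↔ f = g := by
  refine ⟨fun h => ?_, fun h => h ▸ subwordDist_self f⟩
  have hm : ((f.length + 1 : ℕ) : ℕ∞) ≤ subwordDist f g := h ▸ le_top
  exact (natCast_le_subwordDist_iff.1 hm).eq_of_length_lt (Nat.lt_succ_self _)

/-- For `f ≠ g` the distance is a natural number. [cite: Lothaire1997, §6.2 (before 6.2.5)] -/
theorem exists_subwordDist_eq_natCast {f g : List α} (h : f ≠ g) :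
    ∃ d : ℕ, subwordDist f g = d := by
  obtain ⟨d, hd⟩ := ENat.ne_top_iff_exists.1 (fun ht => h (subwordDist_eq_top_iff.1 ht))
  exact ⟨d, hd.symm⟩

/-- `δ(f, g) = d` iff `f ≡ g [J_d]` and `f ≢ g [J_{d+1}]`.
[cite: Lothaire1997, §6.2 (before 6.2.5)] -/
theorem subwordDist_eq_natCast_iff {f g : List α} {d : ℕ} :
    subwordDist f g = d ↔ SubwordEquiv d f g ∧ ¬ SubwordEquiv (d + 1) f g := by
  rw [← natCast_le_subwordDist_iff, ← natCast_le_subwordDist_iff]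
  constructor
  · intro h
    rw [h, Nat.cast_le, Nat.cast_le]
    omega
  · rintro ⟨h1, h2⟩
    have hne : subwordDist f g ≠ ⊤ := fun ht => h2 (ht ▸ le_top)
    obtain ⟨e, he⟩ := ENat.ne_top_iff_exists.1 hne
    rw [← he, Nat.cast_le] at h1 h2
    rw [← he, Nat.cast_inj]
    omega

/-- (6.2.5): `δ(f, g) ≥ min {δ(f, h), δ(g, h)}` — `δ` is an ultrametric "distance" (the larger,
the closer), by transitivity of each `J_m`. [cite: Lothaire1997, §6.2 (6.2.5)] -/
theorem min_subwordDist_le {f g h : List α} :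
    min (subwordDist f h) (subwordDist g h) ≤ subwordDist f g :=
  enat_le_of_forall_natCast_le fun m hm => by
    obtain ⟨h1, h2⟩ := le_min_iff.1 hm
    exact natCast_le_subwordDist_iff.2
      ((natCast_le_subwordDist_iff.1 h1).trans (natCast_le_subwordDist_iff.1 h2).symm)

/-- **Proposition 6.2.10**: if `δ(f, g) ≤ δ(f, h)` then `δ(f, g) = min {δ(f, h), δ(g, h)}`
(of the three distances, the two smallest — the two largest as numbers are excluded — coincide).
[cite: Lothaire1997, Proposition 6.2.10] -/
theorem subwordDist_eq_min {f g h : List α} (hle : subwordDist f g ≤ subwordDist f h) :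
    subwordDist f g = min (subwordDist f h) (subwordDist g h) := by
  have h1 : subwordDist f g ≤ subwordDist g h := by
    have key := min_subwordDist_le (f := g) (g := h) (h := f)
    rw [subwordDist_comm g f, subwordDist_comm h f, min_eq_left hle] at key
    exact key
  exact le_antisymm (le_min hle h1) min_subwordDist_le

/-- Monotonicity under sandwiching: if `x ∣ y ∣ h` then `δ(x, h) ≤ δ(y, h)` (every word
distinguishing `y` and `h` distinguishes `x` and `h`; used in the proof of Theorem 6.2.11).
[cite: Lothaire1997, Theorem 6.2.11 (proof)] -/
theorem subwordDist_le_of_sublist_of_sublist {x y h : List α} (hxy : x <+ y) (hyh : y <+ h) :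
    subwordDist x h ≤ subwordDist y h :=
  enat_le_of_forall_natCast_le fun _ hm =>
    natCast_le_subwordDist_iff.2
      ((natCast_le_subwordDist_iff.1 hm).of_sublist_of_sublist hxy hyh)

end Distance

/-! ### Distinguishing words (Lemmas 6.2.12–6.2.14) -/

section Distinguish

/-- `z` distinguishes `f` and `g`: it is a subword of exactly one of them.
[cite: Lothaire1997, §6.2 (before Lemma 6.2.12)] -/
def Distinguishes (z f g : List α) : Prop := ¬ (z <+ f ↔ z <+ g)

/-- `f ≡ g [J_m]` iff no word of length `≤ m` distinguishes them.
[cite: Lothaire1997, §6.2 (before Lemma 6.2.12)] -/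
theorem subwordEquiv_iff_forall_not_distinguishes {m : ℕ} {f g : List α} :
    SubwordEquiv m f g ↔ ∀ z : List α, z.length ≤ m → ¬ Distinguishes z f g := by
  simp only [SubwordEquiv, Distinguishes, not_not]

/-- Distinguishing is symmetric in `f`, `g`. [cite: Lothaire1997, §6.2 (before Lemma 6.2.12)] -/
theorem Distinguishes.symm {z f g : List α} (h : Distinguishes z f g) : Distinguishes z g f :=
  fun h' => h h'.symm

/-- When `f ∣ g`, a word distinguishes `f` and `g` iff it divides `g` but not `f`.
[cite: Lothaire1997, §6.2 (before Lemma 6.2.12)] -/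
theorem distinguishes_iff_of_sublist {z f g : List α} (hfg : f <+ g) :
    Distinguishes z f g ↔ z <+ g ∧ ¬ z <+ f := by
  unfold Distinguishes
  constructor
  · intro h
    by_cases hz : z <+ f
    · exact absurd ⟨fun _ => hz.trans hfg, fun _ => hz⟩ h
    · by_cases hz' : z <+ g
      · exact ⟨hz', hz⟩
      · exact absurd ⟨fun h' => absurd h' hz, fun h' => absurd h' hz'⟩ h
  · rintro ⟨h1, h2⟩ h
    exact h2 (h.2 h1)

/-- A distinguishing word is longer than `δ(f, g)`. [cite: Lothaire1997, §6.2 (before Lemma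
6.2.12)] -/
theorem subwordDist_lt_length {z f g : List α} (hz : Distinguishes z f g) :
    subwordDist f g < z.length := by
  by_contra hle
  rw [not_lt] at hle
  exact hz (natCast_le_subwordDist_iff.1 hle z le_rfl)

/-- `ℕ∞` bookkeeping: a distinguishing word of length `n + 1` bounds `δ ≤ n` (private helper).
[cite: Lothaire1997, §6.2 (before Lemma 6.2.12)] -/
private theorem subwordDist_le_of_distinguishes {z f g : List α} {n : ℕ}
    (hz : Distinguishes z f g) (hn : z.length ≤ n + 1) : subwordDist f g ≤ n := by
  have hlt := subwordDist_lt_length hz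
  have hne : f ≠ g := by
    rintro rfl
    exact hz Iff.rfl
  obtain ⟨d, hd⟩ := exists_subwordDist_eq_natCast hne
  rw [hd] at hlt ⊢
  have := Nat.cast_lt.1 hlt
  exact Nat.cast_le.2 (by omega)

/-- For `f ≠ g` some word of length exactly `δ(f, g) + 1` distinguishes `f` and `g`; with
`subwordDist_lt_length`: the shortest distinguishing words have length `δ(f, g) + 1`.
[cite: Lothaire1997, §6.2 (before Lemma 6.2.12)] -/
theorem exists_distinguishes_length {f g : List α} (h : f ≠ g) :
    ∃ z : List α, Distinguishes z f g ∧ (z.length : ℕ∞) = subwordDist f g + 1 := by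
  obtain ⟨d, hd⟩ := exists_subwordDist_eq_natCast h
  have hnot : ¬ SubwordEquiv (d + 1) f g := fun H => by
    have := natCast_le_subwordDist_iff.2 H
    rw [hd, Nat.cast_le] at this
    omega
  rw [subwordEquiv_iff_forall_not_distinguishes] at hnot
  push Not at hnot
  obtain ⟨z, hz, hdz⟩ := hnot
  refine ⟨z, hdz, ?_⟩
  have hlt := subwordDist_lt_length hdz
  rw [hd, Nat.cast_lt] at hlt
  rw [hd]
  have : z.length = d + 1 := by omega
  simp [this]

/-- The length of a shortest distinguishing word is `δ(f, g) + 1`.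
[cite: Lothaire1997, §6.2 (before Lemma 6.2.12)] -/
theorem length_eq_of_shortest_distinguishes {z f g : List α} (hz : Distinguishes z f g)
    (hmin : ∀ z' : List α, Distinguishes z' f g → z.length ≤ z'.length) :
    (z.length : ℕ∞) = subwordDist f g + 1 := by
  have hne : f ≠ g := by
    rintro rfl
    exact hz Iff.rfl
  obtain ⟨z', hz', hlen⟩ := exists_distinguishes_length hne
  obtain ⟨d, hd⟩ := exists_subwordDist_eq_natCast hne
  have h1 := subwordDist_lt_length hz
  have h2 := hmin z' hz'
  rw [hd] at h1 hlen ⊢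
  have h1' := Nat.cast_lt.1 h1
  have hlen' : z'.length = d + 1 := by exact_mod_cast hlen
  have : z.length = d + 1 := by omega
  simp [this]

/-- **Lemma 6.2.12** (structure): the words distinguishing `ua` and `u` are exactly the words
`sa` with `s ∣ u` and `sa ∤ u`. [cite: Lothaire1997, Lemma 6.2.12] -/
theorem distinguishes_append_singleton_iff {z u : List α} {a : α} :
    Distinguishes z (u ++ [a]) u ↔ ∃ s, z = s ++ [a] ∧ s <+ u ∧ ¬ s ++ [a] <+ u := by
  constructor
  · intro h
    obtain ⟨h1, h2⟩ := (distinguishes_iff_of_sublist (sublist_append_left u [a])).1 h.symm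
    obtain ⟨z₁, z₂, rfl, hz₁, hz₂⟩ := sublist_append_iff.1 h1
    rcases sublist_singleton.1 hz₂ with rfl | rfl
    · exact absurd (by simpa using hz₁) h2
    · exact ⟨z₁, rfl, hz₁, h2⟩
  · rintro ⟨s, rfl, hs, hsa⟩
    exact Distinguishes.symm
      ((distinguishes_iff_of_sublist (sublist_append_left u [a])).2
        ⟨hs.append (Sublist.refl [a]), hsa⟩)

/-- Lemma 6.2.12, dual form: the words distinguishing `av` and `v` are exactly the words `at`
with `t ∣ v` and `at ∤ v`. [cite: Lothaire1997, Lemma 6.2.12] -/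
theorem distinguishes_cons_iff {z v : List α} {a : α} :
    Distinguishes z (a :: v) v ↔ ∃ t, z = a :: t ∧ t <+ v ∧ ¬ a :: t <+ v := by
  constructor
  · intro h
    obtain ⟨h1, h2⟩ := (distinguishes_iff_of_sublist (sublist_cons_self a v)).1 h.symm
    rcases sublist_cons_iff.1 h1 with h1 | ⟨t, rfl, ht⟩
    · exact absurd h1 h2
    · exact ⟨t, rfl, ht, h2⟩
  · rintro ⟨t, rfl, ht, hat⟩
    exact Distinguishes.symm
      ((distinguishes_iff_of_sublist (sublist_cons_self a v)).2 ⟨ht.cons_cons a, hat⟩)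

/-- **Lemma 6.2.12**: every shortest word distinguishing `ua` and `u` has the form `sa` with
`s ∣ u` and `|s| = δ(ua, u)`. [cite: Lothaire1997, Lemma 6.2.12] -/
theorem shortest_distinguishes_append_singleton {z u : List α} {a : α}
    (hz : Distinguishes z (u ++ [a]) u)
    (hmin : ∀ z' : List α, Distinguishes z' (u ++ [a]) u → z.length ≤ z'.length) :
    ∃ s, z = s ++ [a] ∧ s <+ u ∧ (s.length : ℕ∞) = subwordDist (u ++ [a]) u := by
  obtain ⟨s, rfl, hs, -⟩ := distinguishes_append_singleton_iff.1 hz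
  refine ⟨s, rfl, hs, ?_⟩
  have hlen := length_eq_of_shortest_distinguishes hz hmin
  obtain ⟨d, hd⟩ := exists_subwordDist_eq_natCast (f := u ++ [a]) (g := u) (by simp)
  rw [hd] at hlen ⊢
  have : s.length + 1 = d + 1 := by exact_mod_cast (by simpa using hlen)
  have : s.length = d := by omega
  simp [this]

/-- Lemma 6.2.12 (existence form): there is a word `s ∣ u` with `sa ∤ u` and `|s| = δ(ua, u)`.
[cite: Lothaire1997, Lemma 6.2.12] -/
theorem exists_shortest_append_singleton (u : List α) (a : α) :
    ∃ s, s <+ u ∧ ¬ s ++ [a] <+ u ∧ (s.length : ℕ∞) = subwordDist (u ++ [a]) u := by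
  obtain ⟨z, hz, hlen⟩ := exists_distinguishes_length (f := u ++ [a]) (g := u) (by simp)
  obtain ⟨s, rfl, hs, hsa⟩ := distinguishes_append_singleton_iff.1 hz
  refine ⟨s, hs, hsa, ?_⟩
  obtain ⟨d, hd⟩ := exists_subwordDist_eq_natCast (f := u ++ [a]) (g := u) (by simp)
  rw [hd] at hlen ⊢
  have : s.length + 1 = d + 1 := by exact_mod_cast (by simpa using hlen)
  have : s.length = d := by omega
  simp [this]

/-- Lemma 6.2.12 (dual existence form): there is a word `t ∣ v` with `at ∤ v` and
`|t| = δ(av, v)`. [cite: Lothaire1997, Lemma 6.2.12] -/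
theorem exists_shortest_cons (a : α) (v : List α) :
    ∃ t, t <+ v ∧ ¬ a :: t <+ v ∧ (t.length : ℕ∞) = subwordDist (a :: v) v := by
  obtain ⟨z, hz, hlen⟩ := exists_distinguishes_length (f := a :: v) (g := v) (by simp)
  obtain ⟨t, rfl, ht, hat⟩ := distinguishes_cons_iff.1 hz
  refine ⟨t, ht, hat, ?_⟩
  obtain ⟨d, hd⟩ := exists_subwordDist_eq_natCast (f := a :: v) (g := v) (by simp)
  rw [hd] at hlen ⊢
  have : t.length + 1 = d + 1 := by exact_mod_cast (by simpa using hlen)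
  have : t.length = d := by omega
  simp [this]

/-- **Lemma 6.2.13**: `δ(uav, uv) = δ(ua, u) + δ(av, v)` — the words distinguishing `uav` and
`uv` are the words `sat` with `sa` distinguishing `ua`, `u` and `at` distinguishing `av`, `v`.
[cite: Lothaire1997, Lemma 6.2.13] -/
theorem subwordDist_insert_eq_add (u v : List α) (a : α) :
    subwordDist (u ++ a :: v) (u ++ v) = subwordDist (u ++ [a]) u + subwordDist (a :: v) v := by
  obtain ⟨s, hs, hsa, hslen⟩ := exists_shortest_append_singleton u a
  obtain ⟨t, ht, hat, htlen⟩ := exists_shortest_cons a v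
  have hsub : u ++ v <+ u ++ a :: v := (sublist_cons_self a v).append_left u
  apply le_antisymm
  · -- `sat` distinguishes `uav` and `uv`
    have hz : Distinguishes (s ++ a :: t) (u ++ a :: v) (u ++ v) := by
      refine Distinguishes.symm ((distinguishes_iff_of_sublist hsub).2 ⟨?_, ?_⟩)
      · exact hs.append (ht.cons_cons a)
      · intro h
        rcases sublist_append_split h with h | h
        · exact hsa h
        · exact hat h
    have hb := subwordDist_le_of_distinguishes hz (n := s.length + t.length)
      (by simp only [length_append, length_cons]; omega)
    rw [← hslen, ← htlen]
    exact_mod_cast hb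
  · -- every distinguishing word factors through such `s`, `t`
    have hne : u ++ a :: v ≠ u ++ v := fun h => by simpa using congrArg length h
    obtain ⟨z, hz, hzlen⟩ := exists_distinguishes_length hne
    obtain ⟨hz1, hz2⟩ := (distinguishes_iff_of_sublist hsub).1 hz.symm
    obtain ⟨p, q, rfl, hp, hq⟩ := sublist_append_iff.1 hz1
    rcases sublist_cons_iff.1 hq with hq | ⟨t', rfl, ht'⟩
    · exact absurd (hp.append hq) hz2
    · have hpa : ¬ p ++ [a] <+ u := fun h => by
        have : p ++ [a] ++ t' <+ u ++ v := h.append ht'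
        exact hz2 (by simpa using this)
      have hat' : ¬ a :: t' <+ v := fun h => hz2 (hp.append h)
      have h1 : Distinguishes (p ++ [a]) (u ++ [a]) u :=
        distinguishes_append_singleton_iff.2 ⟨p, rfl, hp, hpa⟩
      have h2 : Distinguishes (a :: t') (a :: v) v := distinguishes_cons_iff.2 ⟨t', rfl, ht', hat'⟩
      have b1 := subwordDist_le_of_distinguishes h1 (n := p.length) (by simp)
      have b2 := subwordDist_le_of_distinguishes h2 (n := t'.length) (by simp)
      obtain ⟨d, hd⟩ := exists_subwordDist_eq_natCast hne
      obtain ⟨d1, hd1⟩ := exists_subwordDist_eq_natCast (f := u ++ [a]) (g := u) (by simp)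
      obtain ⟨d2, hd2⟩ := exists_subwordDist_eq_natCast (f := a :: v) (g := v) (by simp)
      rw [hd] at hzlen ⊢
      rw [hd1] at b1 ⊢
      rw [hd2] at b2 ⊢
      have e : (p ++ a :: t').length = d + 1 := by exact_mod_cast hzlen
      simp only [length_append, length_cons] at e
      have b1' := Nat.cast_le.1 b1
      have b2' := Nat.cast_le.1 b2
      exact_mod_cast (show d1 + d2 ≤ d by omega)

/-- Lemma 6.2.14 under the "without loss of generality" hypothesis
`δ(abw, bw) ≤ δ(bav, av)` of the text (private step). [cite: Lothaire1997, Lemma 6.2.14] -/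
private theorem subwordDist_le_max_aux {u v w : List α} {a b : α} (hab : a ≠ b)
    (h12 : subwordDist (a :: b :: w) (b :: w) ≤ subwordDist (b :: a :: v) (a :: v)) :
    subwordDist (u ++ a :: v) (u ++ b :: w) ≤
      max (subwordDist (u ++ b :: a :: v) (u ++ a :: v))
        (subwordDist (u ++ a :: b :: w) (u ++ b :: w)) := by
  obtain ⟨s, hs, hsb, hslen⟩ := exists_shortest_append_singleton u b
  obtain ⟨t, ht, hat, htlen⟩ := exists_shortest_cons a (b :: w)
  by_cases htv : t <+ v
  · -- case `t ∣ v`: `rat` distinguishes, bound by `δ(uabw, ubw)`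
    obtain ⟨r, hr, hra, hrlen⟩ := exists_shortest_append_singleton u a
    apply le_max_of_le_right
    have hz : Distinguishes (r ++ a :: t) (u ++ a :: v) (u ++ b :: w) := by
      intro hiff
      have h1 : r ++ a :: t <+ u ++ a :: v := hr.append (htv.cons_cons a)
      rcases sublist_append_split (hiff.1 h1) with h | h
      · exact hra h
      · exact hat h
    have hb := subwordDist_le_of_distinguishes hz (n := r.length + t.length)
      (by simp only [length_append, length_cons]; omega)
    rw [subwordDist_insert_eq_add u (b :: w) a, ← hrlen, ← htlen]
    exact_mod_cast hb
  · -- case `t ∤ v`: `sbt` resp. `st` distinguishes, bound by `|s| + |t| ≤ δ(ubav, uav)`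
    apply le_max_of_le_left
    have bound : subwordDist (u ++ a :: v) (u ++ b :: w) ≤ (s.length + t.length : ℕ) := by
      by_cases htw : t <+ w
      · have hz : Distinguishes (s ++ b :: t) (u ++ a :: v) (u ++ b :: w) := by
          intro hiff
          have h1 : s ++ b :: t <+ u ++ b :: w := hs.append (htw.cons_cons b)
          rcases sublist_append_split (hiff.2 h1) with h | h
          · exact hsb h
          · exact htv ((sublist_cons_self b t).trans (cons_sublist_cons_of_ne (Ne.symm hab) h))
        exact subwordDist_le_of_distinguishes hz
          (by simp only [length_append, length_cons]; omega)
      · rcases sublist_cons_iff.1 ht with ht | ⟨t', rfl, ht'⟩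
        · exact absurd ht htw
        · have hz : Distinguishes (s ++ b :: t') (u ++ a :: v) (u ++ b :: w) := by
            intro hiff
            have h1 : s ++ b :: t' <+ u ++ b :: w := hs.append (ht'.cons_cons b)
            rcases sublist_append_split (hiff.2 h1) with h | h
            · exact hsb h
            · exact htv (cons_sublist_cons_of_ne (Ne.symm hab) h)
          exact subwordDist_le_of_distinguishes hz
            (by simp only [length_append, length_cons]; omega)
    refine bound.trans ?_
    rw [subwordDist_insert_eq_add u (a :: v) b, Nat.cast_add, hslen, htlen]
    exact add_le_add le_rfl h12

/-- **Lemma 6.2.14**: for words `u, v, w` and letters `a ≠ b`,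
`δ(uav, ubw) ≤ max {δ(ubav, uav), δ(uabw, ubw)}`. [cite: Lothaire1997, Lemma 6.2.14] -/
theorem subwordDist_le_max {u v w : List α} {a b : α} (hab : a ≠ b) :
    subwordDist (u ++ a :: v) (u ++ b :: w) ≤
      max (subwordDist (u ++ b :: a :: v) (u ++ a :: v))
        (subwordDist (u ++ a :: b :: w) (u ++ b :: w)) := by
  rcases le_total (subwordDist (a :: b :: w) (b :: w)) (subwordDist (b :: a :: v) (a :: v))
    with h | h
  · exact subwordDist_le_max_aux hab h
  · rw [subwordDist_comm, max_comm]
    exact subwordDist_le_max_aux (Ne.symm hab) h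

end Distinguish

/-! ### Theorem 6.2.11, Theorem 6.2.6 and Corollary 6.2.8 -/

section Superword

/-- The inductive step of Theorem 6.2.11 in the case `a ≠ b`, under the text's "without loss of
generality" `δ(f, g) ≤ δ(ubav, f)` (private step: (6.2.14)–(6.2.16) of the proof).
[cite: Lothaire1997, Theorem 6.2.11 (proof)] -/
private theorem superword_step {u v w : List α} {a b : α}
    (ih : ∃ h, u ++ b :: a :: v <+ h ∧ u ++ b :: w <+ h ∧
      subwordDist (u ++ b :: a :: v) (u ++ b :: w) =
        min (subwordDist (u ++ b :: a :: v) h) (subwordDist (u ++ b :: w) h))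
    (hle : subwordDist (u ++ a :: v) (u ++ b :: w) ≤
      subwordDist (u ++ b :: a :: v) (u ++ a :: v)) :
    ∃ h, u ++ a :: v <+ h ∧ u ++ b :: w <+ h ∧
      subwordDist (u ++ a :: v) (u ++ b :: w) =
        min (subwordDist (u ++ a :: v) h) (subwordDist (u ++ b :: w) h) := by
  obtain ⟨h, hf'h, hgh, e15⟩ := ih
  have hff' : u ++ a :: v <+ u ++ b :: a :: v := (sublist_cons_self b (a :: v)).append_left u
  -- (6.2.14): `δ(f, g) = min {δ(f, ubav), δ(g, ubav)}`
  rw [subwordDist_comm (u ++ b :: a :: v)] at hle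
  have e14 := subwordDist_eq_min hle
  -- (6.2.16): `δ(f, h) = min {δ(ubav, h), δ(ubav, f)}`
  have hfh : subwordDist (u ++ a :: v) h ≤ subwordDist (u ++ b :: a :: v) h :=
    subwordDist_le_of_sublist_of_sublist hff' hf'h
  rw [subwordDist_comm (u ++ a :: v) h, subwordDist_comm (u ++ b :: a :: v) h] at hfh
  have e16 := subwordDist_eq_min hfh
  refine ⟨h, hff'.trans hf'h, hgh, ?_⟩
  rw [subwordDist_comm h (u ++ a :: v)] at e16
  rw [e14, e16, subwordDist_comm (u ++ b :: w) (u ++ b :: a :: v), e15,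
    subwordDist_comm h (u ++ b :: a :: v), subwordDist_comm (u ++ a :: v) (u ++ b :: a :: v)]
  -- both sides are `min` of the same three distances
  simp only [min_assoc, min_comm]

/-- **Theorem 6.2.11**: any two words `f`, `g` have a common superword `h` (`f ∣ h`, `g ∣ h`)
with `δ(f, g) = min {δ(f, h), δ(g, h)}`. Induction on `|f'| + |g'|` over the factorizations
`f = uf'`, `g = ug'` (the text's `d(f, g)`), using Lemma 6.2.14 and Proposition 6.2.10.
[cite: Lothaire1997, Theorem 6.2.11] -/
theorem exists_superword_subwordDist_eq_min (f g : List α) :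
    ∃ h, f <+ h ∧ g <+ h ∧ subwordDist f g = min (subwordDist f h) (subwordDist g h) := by
  suffices H : ∀ (n : ℕ) (u f' g' : List α), f'.length + g'.length ≤ n →
      ∃ h, u ++ f' <+ h ∧ u ++ g' <+ h ∧
        subwordDist (u ++ f') (u ++ g') = min (subwordDist (u ++ f') h) (subwordDist (u ++ g') h) by
    simpa using H (f.length + g.length) [] f g le_rfl
  intro n
  induction n with
  | zero =>
    intro u f' g' hn
    have hf' : f' = [] := eq_nil_of_length_eq_zero (by omega)
    have hg' : g' = [] := eq_nil_of_length_eq_zero (by omega)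
    subst hf' hg'
    exact ⟨u, by simp, by simp, by simp⟩
  | succ n ih =>
    intro u f' g' hn
    match f', g' with
    | [], g' =>
      refine ⟨u ++ g', by simp, Sublist.refl _, ?_⟩
      rw [subwordDist_self]
      exact (min_eq_left le_top).symm
    | a :: v, [] =>
      refine ⟨u ++ a :: v, Sublist.refl _, by simp, ?_⟩
      rw [subwordDist_self, subwordDist_comm (u ++ []) (u ++ a :: v)]
      exact (min_eq_right le_top).symm
    | a :: v, b :: w =>
      simp only [length_cons] at hn
      by_cases hab : a = b
      · subst hab
        obtain ⟨h, h1, h2, h3⟩ := ih (u ++ [a]) v w (by omega)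
        exact ⟨h, by simpa using h1, by simpa using h2, by simpa using h3⟩
      · rcases le_max_iff.1 (subwordDist_le_max (u := u) (v := v) (w := w) hab) with hle | hle
        · have ih' := ih (u ++ [b]) (a :: v) w (by simp; omega)
          simp only [append_assoc, singleton_append] at ih'
          exact superword_step ih' hle
        · have ih' := ih (u ++ [a]) (b :: w) v (by simp; omega)
          simp only [append_assoc, singleton_append] at ih'
          rw [subwordDist_comm] at hle
          obtain ⟨h, h1, h2, h3⟩ := superword_step ih' hle
          exact ⟨h, h2, h1, by rw [subwordDist_comm, h3, min_comm]⟩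

/-- **Theorem 6.2.6**: if `f ≡ g [J_m]` there is a word `h ≡ f [J_m]` (hence `≡ g`) of which
both `f` and `g` are subwords. [cite: Lothaire1997, Theorem 6.2.6] -/
theorem SubwordEquiv.exists_common_superword {m : ℕ} {f g : List α} (hfg : SubwordEquiv m f g) :
    ∃ h, f <+ h ∧ g <+ h ∧ SubwordEquiv m f h ∧ SubwordEquiv m g h := by
  obtain ⟨h, hf, hg, e⟩ := exists_superword_subwordDist_eq_min f g
  have hm := natCast_le_subwordDist_iff.2 hfg
  rw [e, le_min_iff] at hm
  exact ⟨h, hf, hg, natCast_le_subwordDist_iff.1 hm.1, natCast_le_subwordDist_iff.1 hm.2⟩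

/-- A proper subword misses (at least) one letter position: if `x ∣ y`, `x ≠ y` then
`y = uav` with `x ∣ uv`. [cite: Lothaire1997, Corollary 6.2.8 (proof)] -/
theorem exists_remove_letter_of_sublist {x y : List α} (h : x <+ y) (hne : x ≠ y) :
    ∃ u a v, y = u ++ a :: v ∧ x <+ u ++ v := by
  induction h with
  | slnil => exact absurd rfl hne
  | @cons x y a h _ => exact ⟨[], a, y, rfl, h⟩
  | @cons_cons x y a h ih =>
    obtain ⟨u, b, v, rfl, hx⟩ := ih (fun e => hne (by rw [e]))
    exact ⟨a :: u, b, v, rfl, hx.cons_cons a⟩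

/-- The step of Corollary 6.2.8: if `uv ≡ uav [J_m]` then `uav ≡ ua²v [J_m]` (a subword
`w` of `uaav` of length `≤ m` not dividing `uav` factors as `w = saat` with `s ∣ u`, `t ∣ v`;
then `sat ∣ uav` has length `≤ m − 1`, so `sat ∣ uv`, whence `sa ∣ u` or `at ∣ v`, and
`w ∣ uav` after all). [cite: Lothaire1997, Corollary 6.2.8] -/
theorem SubwordEquiv.insert_letter_step {m : ℕ} {u v : List α} {a : α}
    (h : SubwordEquiv m (u ++ v) (u ++ a :: v)) :
    SubwordEquiv m (u ++ a :: v) (u ++ a :: a :: v) := by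
  have hsub : u ++ a :: v <+ u ++ a :: a :: v := (sublist_cons_self a (a :: v)).append_left u
  intro w hw
  refine ⟨fun hw' => hw'.trans hsub, fun hw' => ?_⟩
  by_contra hnot
  obtain ⟨p, q, rfl, hp, hq⟩ := sublist_append_iff.1 hw'
  rcases sublist_cons_iff.1 hq with hq | ⟨q', rfl, hq'⟩
  · exact hnot (hp.append hq)
  rcases sublist_cons_iff.1 hq' with hq' | ⟨t, rfl, ht⟩
  · exact hnot (hp.append (hq'.cons_cons a))
  -- `w = p a a t`, `p ∣ u`, `t ∣ v`; now `p a t ∣ uav` has length `≤ m`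
  have hpat : p ++ a :: t <+ u ++ a :: v := hp.append (ht.cons_cons a)
  have hlen : (p ++ a :: t).length ≤ m := by
    simp only [length_append, length_cons] at hw ⊢
    omega
  have hpat' : p ++ a :: t <+ u ++ v := ((h _ hlen).2 hpat)
  rcases sublist_append_split hpat' with h1 | h1
  · -- `pa ∣ u`: then `w = (pa)(at) ∣ u (av)`
    exact hnot (by simpa using h1.append (ht.cons_cons a))
  · -- `at ∣ v`: then `w = p (a a t) ∣ u (a v)`
    exact hnot (hp.append (h1.cons_cons a))

/-- Corollary 6.2.8 (pumping): if `uv ≡ uav [J_m]` then `uv ≡ uaⁿv [J_m]` for every `n`.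
[cite: Lothaire1997, Corollary 6.2.8] -/
theorem SubwordEquiv.insert_letter_pump {m : ℕ} {u v : List α} {a : α}
    (h : SubwordEquiv m (u ++ v) (u ++ a :: v)) (n : ℕ) :
    SubwordEquiv m (u ++ v) (u ++ replicate n a ++ v) := by
  -- `Q k : u aᵏ v ≡ u aᵏ⁺¹ v`, by the step applied to `u aᵏ`
  have Q : ∀ k : ℕ, SubwordEquiv m (u ++ replicate k a ++ v) (u ++ replicate (k + 1) a ++ v) := by
    intro k
    induction k with
    | zero => simpa using h
    | succ k ihk =>
      have := SubwordEquiv.insert_letter_step (u := u ++ replicate k a) (v := v) (a := a)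
        (by simpa [replicate_succ', append_assoc] using ihk)
      simpa [replicate_succ', append_assoc] using this
  induction n with
  | zero => simpa using SubwordEquiv.refl m (u ++ v)
  | succ n ihn => exact ihn.trans (Q n)

/-- **Corollary 6.2.8**: every congruence class of `J_m` is either a singleton or infinite.
[cite: Lothaire1997, Corollary 6.2.8] -/
theorem subwordEquiv_class_singleton_or_infinite (m : ℕ) (f : List α) :
    (∀ g, SubwordEquiv m f g → g = f) ∨ {g | SubwordEquiv m f g}.Infinite := by
  by_cases H : ∀ g, SubwordEquiv m f g → g = f
  · exact Or.inl H
  right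
  push Not at H
  obtain ⟨g, hfg, hgf⟩ := H
  -- a pair `x ∣ y`, `x ≠ y` inside the class
  obtain ⟨x, y, hxy, hne, hxye, hfy⟩ : ∃ x y : List α, x <+ y ∧ x ≠ y ∧ SubwordEquiv m x y ∧
      SubwordEquiv m f y := by
    obtain ⟨h, hfh, hgh, efh, egh⟩ := hfg.exists_common_superword
    by_cases e : h = f
    · subst e
      exact ⟨g, h, hgh, hgf, egh, SubwordEquiv.refl m h⟩
    · exact ⟨f, h, hfh, Ne.symm e, efh, efh⟩
  obtain ⟨u, a, v, rfl, hx⟩ := exists_remove_letter_of_sublist hxy hne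
  have huv : SubwordEquiv m (u ++ v) (u ++ a :: v) :=
    (hxye.of_sublist_of_sublist hx ((sublist_cons_self a v).append_left u))
  have hmem : ∀ n : ℕ, SubwordEquiv m f (u ++ replicate n a ++ v) := fun n =>
    (hfy.trans huv.symm).trans (huv.insert_letter_pump n)
  refine Set.infinite_of_injective_forall_mem (f := fun n : ℕ => u ++ replicate n a ++ v)
    ?_ hmem
  intro i j hij
  have := congrArg length hij
  simp only [length_append, length_replicate] at this
  omega

end Superword

/-! ### The alphabet criterion (6.2.19), Corollary 6.2.16, Example 6.2.7 -/

section Alphabet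

/-- Letters occurring in every block can be threaded one per block: if every letter of `y`
occurs in every word of `L` and `|y| ≤ |L|` then `y` is a subword of the product of `L`
(the step "`t'` is a subword of `v₁ ⋯ v_k`" of (6.2.19)). [cite: Lothaire1997, Proposition
6.2.15 (proof of (6.2.19))] -/
theorem sublist_flatten_of_forall_mem :
    ∀ {y : List α} {L : List (List α)}, (∀ c ∈ y, ∀ B ∈ L, c ∈ B) → y.length ≤ L.length →
      y <+ L.flatten
  | [], _, _, _ => nil_sublist _
  | _ :: _, [], _, h => by simp at h
  | c :: y, B :: L, h, hlen => by
    rw [flatten_cons]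
    have hc : c ∈ B := h c mem_cons_self B mem_cons_self
    have ih := sublist_flatten_of_forall_mem (y := y) (L := L)
      (fun d hd B' hB' => h d (mem_cons_of_mem c hd) B' (mem_cons_of_mem B hB'))
      (by simp only [length_cons] at hlen; omega)
    exact (singleton_sublist.2 hc).append ih

/-- Inner induction of `sublist_flatten_drop_of_pairwise_subset`: move the letters of the
first block to the right one at a time (private step). [cite: Lothaire1997, Proposition 6.2.15
(proof of (6.2.19))] -/
private theorem sublist_flatten_drop_aux {B : List α} {rest : List (List α)}
    (ih : ∀ {x : List α}, x <+ rest.flatten → x.length ≤ rest.length →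
      x <+ (rest.drop (rest.length - x.length)).flatten)
    (hB : ∀ B' ∈ rest, B ⊆ B') :
    ∀ (k : ℕ) {x₁ x' : List α}, x₁.length ≤ k → x₁ <+ B → x' <+ rest.flatten →
      (x₁ ++ x').length ≤ rest.length →
      x₁ ++ x' <+ (rest.drop (rest.length - (x₁ ++ x').length)).flatten := by
  intro k
  induction k with
  | zero =>
    intro x₁ x' hk _ hx' hlen
    obtain rfl : x₁ = [] := eq_nil_of_length_eq_zero (by omega)
    exact ih hx' (by simpa using hlen)
  | succ k ihk =>
    intro x₁ x' hk h₁ hx' hlen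
    rcases eq_nil_or_concat' x₁ with rfl | ⟨x₁', c, rfl⟩
    · exact ih hx' (by simpa using hlen)
    · -- move the last letter `c` of the `B`-part into the first block of `rest`
      have hc : c ∈ B := h₁.subset (by simp)
      obtain ⟨B₂, rest', rfl⟩ : ∃ B₂ rest', rest = B₂ :: rest' := by
        rcases rest with _ | ⟨B₂, rest'⟩
        · simp at hlen
        · exact ⟨B₂, rest', rfl⟩
      have hc₂ : c ∈ B₂ := hB B₂ mem_cons_self hc
      -- `x'` fits into the blocks after `B₂`
      have hx'' : x' <+ rest'.flatten := by
        have h0 := ih hx' (by simp at hlen ⊢; omega)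
        have hd : (B₂ :: rest').drop ((B₂ :: rest').length - x'.length) <+ rest' := by
          obtain ⟨j, hj⟩ : ∃ j, (B₂ :: rest').length - x'.length = j + 1 :=
            ⟨(B₂ :: rest').length - x'.length - 1, by simp at hlen ⊢; omega⟩
          rw [hj, drop_succ_cons]
          exact drop_sublist j rest'
        exact h0.trans hd.flatten
      have key := ihk (x₁ := x₁') (x' := c :: x') (by simp at hk; omega)
        ((sublist_append_left x₁' [c]).trans h₁)
        (by rw [flatten_cons]; exact (singleton_sublist.2 hc₂).append hx'')
        (by simpa using hlen)
      simpa using key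

/-- Under an increasing chain of alphabets `alph(v₁) ⊆ ⋯ ⊆ alph(v_n)`, a subword `x` of
`v₁ ⋯ v_n` with `|x| ≤ n` is a subword of the last `|x|` blocks (the step "`v'` is a subword
of `v_{k+1} ⋯ v_m`" of (6.2.19)). [cite: Lothaire1997, Proposition 6.2.15 (proof of (6.2.19))] -/
theorem sublist_flatten_drop_of_pairwise_subset :
    ∀ {L : List (List α)}, L.Pairwise (· ⊆ ·) → ∀ {x : List α}, x <+ L.flatten →
      x.length ≤ L.length → x <+ (L.drop (L.length - x.length)).flatten
  | [], _, x, hx, _ => by simpa using hx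
  | B :: rest, hL, x, hx, hlen => by
    rw [pairwise_cons] at hL
    by_cases htop : x.length = (B :: rest).length
    · rw [htop, Nat.sub_self, drop_zero]
      exact hx
    · have hlen' : x.length ≤ rest.length := by
        simp only [length_cons] at hlen htop
        omega
      rw [flatten_cons] at hx
      obtain ⟨x₁, x', rfl, h₁, hx'⟩ := sublist_append_iff.1 hx
      have key := sublist_flatten_drop_aux (B := B) (rest := rest)
        (fun hx hl => sublist_flatten_drop_of_pairwise_subset hL.2 hx hl) hL.1
        x₁.length le_rfl h₁ hx' hlen'
      have e : (B :: rest).length - (x₁ ++ x').length =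
          (rest.length - (x₁ ++ x').length) + 1 := by
        simp only [length_cons] at hlen' ⊢
        omega
      rw [e, drop_succ_cons]
      exact key

/-- **(6.2.19)** (Proposition 6.2.15, first half of the proof): if `v = v₁ ⋯ v_m` with
`alph(t) ⊆ alph(v₁) ⊆ ⋯ ⊆ alph(v_m)` (condition `P(m; t; v)`), then every subword of `tv` of
length `≤ m` is a subword of `v`, i.e. `tv ≡ v [J_m]`: a subword `s = t'v'` (`t' ∣ t`,
`v' ∣ v`, `k = |t'|`) re-embeds with `t'` in `v₁ ⋯ v_k` and `v'` in `v_{k+1} ⋯ v_m`.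
[cite: Lothaire1997, Proposition 6.2.15 (6.2.19)] -/
theorem subwordEquiv_append_flatten {m : ℕ} {t : List α} {L : List (List α)}
    (hlen : L.length = m) (ht : ∀ B ∈ L, t ⊆ B) (hL : L.Pairwise (· ⊆ ·)) :
    SubwordEquiv m (t ++ L.flatten) L.flatten := by
  intro s hs
  refine ⟨fun h => ?_, fun h => h.trans (sublist_append_right t _)⟩
  obtain ⟨t', v', rfl, ht', hv'⟩ := sublist_append_iff.1 h
  simp only [length_append] at hs
  -- `t'` threads through the first `|t'|` blocks
  have h1 : t' <+ (L.take t'.length).flatten :=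
    sublist_flatten_of_forall_mem
      (fun c hc B hB => ht B (mem_of_mem_take hB) (ht'.subset hc))
      (by simp only [length_take]; omega)
  -- `v'` fits into the last `|v'|` blocks, which come after the first `|t'|`
  have h2 : v' <+ (L.drop t'.length).flatten := by
    have h0 := sublist_flatten_drop_of_pairwise_subset hL hv' (by omega)
    have hd : L.drop (L.length - v'.length) <+ L.drop t'.length := by
      have e : L.drop (L.length - v'.length) =
          (L.drop t'.length).drop (L.length - v'.length - t'.length) := by
        rw [drop_drop]
        congr 1
        omega
      rw [e]
      exact drop_sublist _ _
    exact h0.trans hd.flatten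
  have key := h1.append h2
  rwa [← flatten_append, take_append_drop] at key

/-- Equal blocks form an increasing chain of alphabets (private helper for Corollary 6.2.16).
[cite: Lothaire1997, Corollary 6.2.16] -/
private theorem pairwise_subset_replicate (B : List α) :
    ∀ n : ℕ, (replicate n B).Pairwise (· ⊆ ·)
  | 0 => Pairwise.nil
  | n + 1 => by
    rw [replicate_succ, pairwise_cons]
    refine ⟨fun B' hB' => ?_, pairwise_subset_replicate B n⟩
    rw [eq_of_mem_replicate hB']
    exact Subset.refl B

/-- **Corollary 6.2.16**: for all words `f, g` and every `m > 0` (and trivially for `m = 0`),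
`(fg)^m ≡ g(fg)^m [J_m]` — (6.2.19) with `t = g` and the factorization `v₁ = ⋯ = v_m = fg`.
[cite: Lothaire1997, Corollary 6.2.16] -/
theorem subwordEquiv_pow_cons_pow (m : ℕ) (f g : List α) :
    SubwordEquiv m (replicate m (f ++ g)).flatten (g ++ (replicate m (f ++ g)).flatten) :=
  (subwordEquiv_append_flatten (length_replicate ..)
    (fun B hB => by
      rw [eq_of_mem_replicate hB]
      exact subset_append_right f g)
    (pairwise_subset_replicate (f ++ g) m)).symm

/-- **Example 6.2.7**: `m = 4`, `f = a²b⁴a⁴b²`, `g = a³b³a³b³`, `h = a³b⁴a⁴b³` (`a = 0`,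
`b = 1`): `f, g ∣ h`, `δ(f, h) = 4 = δ(g, h)`, and consequently `f ≡ g [J_4]` (checked by the
kernel through `instDecidableSubwordEquiv`). [cite: Lothaire1997, Example 6.2.7] -/
example :
    ([0,0,1,1,1,1,0,0,0,0,1,1] : List (Fin 2)) <+ [0,0,0,1,1,1,1,0,0,0,0,1,1,1] ∧
    ([0,0,0,1,1,1,0,0,0,1,1,1] : List (Fin 2)) <+ [0,0,0,1,1,1,1,0,0,0,0,1,1,1] ∧
    subwordDist ([0,0,1,1,1,1,0,0,0,0,1,1] : List (Fin 2)) [0,0,0,1,1,1,1,0,0,0,0,1,1,1]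
      = (4 : ℕ) ∧
    subwordDist ([0,0,0,1,1,1,0,0,0,1,1,1] : List (Fin 2)) [0,0,0,1,1,1,1,0,0,0,0,1,1,1]
      = (4 : ℕ) ∧
    SubwordEquiv 4 ([0,0,1,1,1,1,0,0,0,0,1,1] : List (Fin 2)) [0,0,0,1,1,1,0,0,0,1,1,1] := by
  refine ⟨by decide +kernel, by decide +kernel, ?_, ?_, by decide +kernel⟩
  · exact subwordDist_eq_natCast_iff.2 ⟨by decide +kernel, by decide +kernel⟩
  · exact subwordDist_eq_natCast_iff.2 ⟨by decide +kernel, by decide +kernel⟩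

end Alphabet

/-! ### Problems 6.2.2, 6.2.3, 6.2.5, 6.2.6 and 6.2.7 -/

section Problems

/-- Dual of `exists_remove_letter_of_sublist`: a proper subword `x` of `y` can be enlarged by
one letter inside `y` — `x = uv` with `uav ∣ y` (the relation `R_m` of Problem 6.2.5 climbs from
`x` to `y`). [cite: Lothaire1997, Problem 6.2.5] -/
theorem exists_insert_letter_of_sublist {x y : List α} (h : x <+ y) (hne : x ≠ y) :
    ∃ u a v, x = u ++ v ∧ u ++ a :: v <+ y := by
  induction h with
  | slnil => exact absurd rfl hne
  | @cons x y a h ih =>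
    by_cases e : x = y
    · subst e
      exact ⟨[], a, x, rfl, Sublist.refl _⟩
    · obtain ⟨u, c, v, rfl, huv⟩ := ih e
      exact ⟨u, c, v, rfl, huv.cons a⟩
  | @cons_cons x y a h ih =>
    obtain ⟨u, c, v, rfl, huv⟩ := ih (fun e => hne (by rw [e]))
    exact ⟨a :: u, c, v, rfl, huv.cons_cons a⟩

/-- The relation `R_m` of Problem 6.2.5: `fg R_m fag` for `f, g ∈ A*`, `a ∈ A` with
`fg ≡ fag [J_m]` (one letter is inserted and the class is kept).
[cite: Lothaire1997, Problem 6.2.5] -/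
def InsertStep (m : ℕ) (x y : List α) : Prop :=
  ∃ u a v, x = u ++ v ∧ y = u ++ a :: v ∧ SubwordEquiv m x y

/-- **Problem 6.2.5** (first part): `R_m^*` is the intersection of the division relation with
`J_m` — going up letter by letter inside a `J_m`-class (by `exists_insert_letter_of_sublist` and
the sandwich `SubwordEquiv.of_sublist_of_sublist`). [cite: Lothaire1997, Problem 6.2.5] -/
theorem reflTransGen_insertStep_iff {m : ℕ} {f g : List α} :
    Relation.ReflTransGen (InsertStep m) f g ↔ f <+ g ∧ SubwordEquiv m f g := by
  constructor
  · intro h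
    induction h with
    | refl => exact ⟨Sublist.refl _, SubwordEquiv.refl m f⟩
    | tail _ hst ih =>
      obtain ⟨u, a, v, rfl, rfl, he⟩ := hst
      exact ⟨ih.1.trans ((sublist_cons_self a v).append_left u), ih.2.trans he⟩
  · -- induction on `|g| - |f|`
    suffices H : ∀ (n : ℕ) (f : List α), g.length - f.length ≤ n → f <+ g →
        SubwordEquiv m f g → Relation.ReflTransGen (InsertStep m) f g from
      fun h => H _ f le_rfl h.1 h.2
    intro n
    induction n with
    | zero =>
      intro f hn hfg _
      rw [hfg.eq_of_length_le (by omega)]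
    | succ n ih =>
      intro f hn hfg he
      by_cases hne : f = g
      · rw [hne]
      · obtain ⟨u, a, v, rfl, huav⟩ := exists_insert_letter_of_sublist hfg hne
        have hsub : u ++ v <+ u ++ a :: v := (sublist_cons_self a v).append_left u
        have h1 : SubwordEquiv m (u ++ a :: v) g := he.of_sublist_of_sublist hsub huav
        have hstep : InsertStep m (u ++ v) (u ++ a :: v) :=
          ⟨u, a, v, rfl, rfl, he.trans h1.symm⟩
        refine Relation.ReflTransGen.head hstep (ih _ ?_ huav h1)
        simp only [length_append, length_cons] at hn ⊢
        omega

/-- **Problem 6.2.5** (second part): `J_m = R_m^{-1*} ∘ R_m^*` — two words are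
`J_m`-congruent iff they climb by `R_m`-steps to a common word (Theorem 6.2.6).
[cite: Lothaire1997, Problem 6.2.5] -/
theorem subwordEquiv_iff_join_insertStep {m : ℕ} {f g : List α} :
    SubwordEquiv m f g ↔ Relation.Join (Relation.ReflTransGen (InsertStep m)) f g := by
  constructor
  · intro h
    obtain ⟨w, hf, hg, ef, eg⟩ := h.exists_common_superword
    exact ⟨w, reflTransGen_insertStep_iff.2 ⟨hf, ef⟩, reflTransGen_insertStep_iff.2 ⟨hg, eg⟩⟩
  · rintro ⟨w, hf, hg⟩
    exact (reflTransGen_insertStep_iff.1 hf).2.trans (reflTransGen_insertStep_iff.1 hg).2.symm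

/-- Problem 6.2.5 (second part, continued): `J_m = (R_m ∪ R_m^{-1})^*`, the equivalence
generated by `R_m`. [cite: Lothaire1997, Problem 6.2.5] -/
theorem subwordEquiv_iff_eqvGen_insertStep {m : ℕ} {f g : List α} :
    SubwordEquiv m f g ↔ Relation.EqvGen (InsertStep m) f g := by
  constructor
  · intro h
    obtain ⟨w, hf, hg⟩ := subwordEquiv_iff_join_insertStep.1 h
    have lift : ∀ {x y : List α}, Relation.ReflTransGen (InsertStep m) x y →
        Relation.EqvGen (InsertStep m) x y := by
      intro x y hxy
      induction hxy with
      | refl => exact Relation.EqvGen.refl _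
      | tail _ hst ih => exact Relation.EqvGen.trans _ _ _ ih (Relation.EqvGen.rel _ _ hst)
    exact Relation.EqvGen.trans _ _ _ (lift hf) (Relation.EqvGen.symm _ _ (lift hg))
  · intro h
    induction h with
    | rel _ _ hst =>
      obtain ⟨_, _, _, _, _, hst⟩ := hst
      exact hst
    | refl x => exact SubwordEquiv.refl m x
    | symm _ _ _ ih => exact ih.symm
    | trans _ _ _ _ _ ih1 ih2 => exact ih1.trans ih2

/-- **Problem 6.2.6**: `[f]_m` is a singleton iff `δ(gah, gh) < m` for every factorization
`f = gh` and every letter `a` (no letter can be inserted into `f` inside its class: a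
non-singleton class is infinite by Corollary 6.2.8, so has a member not below `f`, and
Theorem 6.2.6 then gives a member strictly above `f`). [cite: Lothaire1997, Problem 6.2.6] -/
theorem subwordEquiv_class_eq_singleton_iff {m : ℕ} {f : List α} :
    (∀ f', SubwordEquiv m f f' → f' = f) ↔
      ∀ (g h : List α) (a : α), f = g ++ h → subwordDist (g ++ a :: h) (g ++ h) < m := by
  constructor
  · intro H g h a hf
    by_contra hle
    rw [not_lt] at hle
    have he : SubwordEquiv m (g ++ a :: h) (g ++ h) := natCast_le_subwordDist_iff.1 hle
    have := congrArg length (H _ (hf ▸ he.symm))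
    simp [hf] at this
  · intro H f' he
    by_contra hne
    have hinf : {g | SubwordEquiv m f g}.Infinite := by
      rcases subwordEquiv_class_singleton_or_infinite m f with h1 | h1
      · exact absurd (h1 f' he) hne
      · exact h1
    -- an infinite class is not contained in the finite set of subwords of `f`
    obtain ⟨f'', hf'', hnot⟩ : ∃ f'', SubwordEquiv m f f'' ∧ ¬ f'' <+ f := by
      by_contra hall
      push Not at hall
      exact hinf ((f.sublists.finite_toSet).subset fun g hg => mem_sublists.2 (hall g hg))
    -- a common superword of `f`, `f''` in the class lies strictly above `f`: insert a letter
    obtain ⟨w, hfw, hf''w, efw, -⟩ := hf''.exists_common_superword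
    have hw : f ≠ w := by
      rintro rfl
      exact hnot hf''w
    obtain ⟨g, a, h, rfl, hgah⟩ := exists_insert_letter_of_sublist hfw hw
    have e : SubwordEquiv m (g ++ a :: h) w :=
      efw.of_sublist_of_sublist ((sublist_cons_self a h).append_left g) hgah
    have e' : SubwordEquiv m (g ++ a :: h) (g ++ h) := e.trans efw.symm
    exact absurd (natCast_le_subwordDist_iff.2 e') (not_le.2 (H g h a rfl))

/-- **Problem 6.2.7**: `f` is a minimal element of `[f]_m` (for the division ordering) iff
`δ(gah, gh) < m` whenever `f = gah` (no letter of `f` can be erased inside its class).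
[cite: Lothaire1997, Problem 6.2.7] -/
theorem minimal_in_subwordEquiv_class_iff {m : ℕ} {f : List α} :
    (∀ f', SubwordEquiv m f f' → f' <+ f → f' = f) ↔
      ∀ (g h : List α) (a : α), f = g ++ a :: h → subwordDist (g ++ a :: h) (g ++ h) < m := by
  constructor
  · intro H g h a hf
    by_contra hle
    rw [not_lt] at hle
    have he : SubwordEquiv m (g ++ a :: h) (g ++ h) := natCast_le_subwordDist_iff.1 hle
    have := congrArg length
      (H _ (hf ▸ he) (hf ▸ (sublist_cons_self a h).append_left g))
    simp [hf] at this
  · intro H f' he hf'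
    by_contra hne
    obtain ⟨g, a, h, rfl, hgh⟩ := exists_remove_letter_of_sublist hf' hne
    have e : SubwordEquiv m (g ++ h) (g ++ a :: h) :=
      he.symm.of_sublist_of_sublist hgh ((sublist_cons_self a h).append_left g)
    have := H g h a rfl
    rw [subwordDist_comm] at this
    exact absurd (natCast_le_subwordDist_iff.2 e) (not_le.2 this)

/-- One direction of Problem 6.2.3 (private step): over the alphabet `{a, b}`, `f ≡ g [J_m]`
gives `S(m + 1, abf) ⊆ S(m + 1, abg)`. [cite: Lothaire1997, Problem 6.2.3] -/
private theorem sublist_cons_cons_of_subwordEquiv {a b : α} (h2 : ∀ c : α, c = a ∨ c = b)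
    {m : ℕ} {f g : List α} (he : SubwordEquiv m f g) {s : List α} (hs : s.length ≤ m + 1)
    (hsf : s <+ a :: b :: f) : s <+ a :: b :: g := by
  have hsf' : s <+ [a, b] ++ f := hsf
  obtain ⟨p, q, rfl, hp, hq⟩ := sublist_append_iff.1 hsf'
  simp only [length_append] at hs
  rcases p with _ | ⟨c, p'⟩
  · -- `s = q ∣ f`: re-embed the first letter of `s` into `ab`
    rcases q with _ | ⟨c, q'⟩
    · exact nil_sublist _
    · have hq' : q' <+ g := (he q' (by simp only [length_cons, length_nil] at hs; omega)).1
        ((sublist_cons_self c q').trans hq)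
      have hc : [c] <+ [a, b] := by
        rcases h2 c with rfl | rfl <;> simp
      exact (hc.append hq' : [c] ++ q' <+ [a, b] ++ g)
  · -- a nonempty part of `s` lies in `ab`, so `|q| ≤ m`
    have hq' : q <+ g := (he q (by simp only [length_cons] at hs; omega)).1 hq
    exact (hp.append hq' : (c :: p') ++ q <+ [a, b] ++ g)

/-- **Problem 6.2.3**: over a two-letter alphabet `A = {a, b}`, `abf ≡ abg [J_{m+1}]` iff
`f ≡ g [J_m]` (stated with `m + 1`, `m` for the text's `m`, `m − 1`).
[cite: Lothaire1997, Problem 6.2.3] -/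
theorem subwordEquiv_cons_cons_iff_of_two_letters {a b : α} (hab : a ≠ b)
    (h2 : ∀ c : α, c = a ∨ c = b) {m : ℕ} {f g : List α} :
    SubwordEquiv (m + 1) (a :: b :: f) (a :: b :: g) ↔ SubwordEquiv m f g := by
  constructor
  · -- `s ∣ f` iff `bs ∣ abf`
    suffices key : ∀ {f g : List α}, SubwordEquiv (m + 1) (a :: b :: f) (a :: b :: g) →
        ∀ s : List α, s.length ≤ m → s <+ f → s <+ g from
      fun h s hs => ⟨key h s hs, key h.symm s hs⟩
    intro f g h s hs hsf
    have h1 : b :: s <+ a :: b :: f := ((hsf.cons_cons b).cons a)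
    have h2' := (h (b :: s) (by simp only [length_cons]; omega)).1 h1
    have h3 : b :: s <+ b :: g := cons_sublist_cons_of_ne (Ne.symm hab) h2'
    exact cons_sublist_cons.1 h3
  · intro he s hs
    exact ⟨sublist_cons_cons_of_subwordEquiv h2 he hs,
      sublist_cons_cons_of_subwordEquiv h2 he.symm hs⟩

/-- One half of the induction in Problem 6.2.2 (private step): if `af ≡ bg [J_m]` over
`{a, b}`, `a ≠ b`, and `s'` is a subword of both `af` and `bg`, then `as' ∣ af` provided
`|as'| ≤ m`. [cite: Lothaire1997, Problem 6.2.2] -/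
private theorem cons_sublist_of_subwordEquiv_cons {a b : α} (hab : a ≠ b) {m : ℕ}
    {f g : List α} (he : SubwordEquiv m (a :: f) (b :: g)) {s' : List α}
    (hs : s'.length + 1 ≤ m) (h1 : s' <+ a :: f) (h2 : s' <+ b :: g) : a :: s' <+ a :: f := by
  by_contra hnot
  have hs'f : ¬ s' <+ f := fun h => hnot (h.cons_cons a)
  rcases sublist_cons_iff.1 h1 with h1 | ⟨s'', rfl, hs''⟩
  · exact hs'f h1
  · -- `s' = a s''`, `s'' ∣ f`, `a s'' ∤ f`; but `a s'' ∣ bg` forces `a s'' ∣ g`, so `b a s'' ∣ bg`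
    have hg : a :: s'' <+ g := cons_sublist_cons_of_ne hab h2
    have h3 : b :: a :: s'' <+ b :: g := hg.cons_cons b
    have h4 := (he (b :: a :: s'') (by simp only [length_cons] at hs ⊢; omega)).2 h3
    have h5 : b :: a :: s'' <+ f := cons_sublist_cons_of_ne (Ne.symm hab) h4
    exact hs'f ((sublist_cons_self b _).trans h5)

/-- **Problem 6.2.2**: over a two-letter alphabet `A = {a, b}` (`a ≠ b`), `af ≡ bg [J_m]` iff
`S(m, af) = S(m, bg) = A^{≤ m}`, i.e. iff every word of length `≤ m` is a subword of both
`af` and `bg`. [cite: Lothaire1997, Problem 6.2.2] -/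
theorem subwordEquiv_cons_iff_of_two_letters {a b : α} (hab : a ≠ b)
    (h2 : ∀ c : α, c = a ∨ c = b) {m : ℕ} {f g : List α} :
    SubwordEquiv m (a :: f) (b :: g) ↔
      (∀ s : List α, s.length ≤ m → s <+ a :: f) ∧
        (∀ s : List α, s.length ≤ m → s <+ b :: g) := by
  constructor
  · intro he
    -- every word of length `≤ m` divides `af` (and hence `bg`), by induction on the word
    have key : ∀ s : List α, s.length ≤ m → s <+ a :: f := by
      intro s
      induction s with
      | nil => exact fun _ => nil_sublist _
      | cons c s' ih =>
        intro hs
        simp only [length_cons] at hs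
        have h1 : s' <+ a :: f := ih (by omega)
        have h1' : s' <+ b :: g := (he s' (by omega)).1 h1
        rcases h2 c with rfl | rfl
        · exact cons_sublist_of_subwordEquiv_cons hab he (by omega) h1 h1'
        · have := cons_sublist_of_subwordEquiv_cons (Ne.symm hab) he.symm (by omega) h1' h1
          exact (he _ (by simp only [length_cons]; omega)).2 this
    exact ⟨key, fun s hs => (he s hs).1 (key s hs)⟩
  · rintro ⟨hf, hg⟩ s hs
    exact ⟨fun _ => hg s hs, fun _ => hf s hs⟩

end Problems

end Literature.Combinatorics.Words
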